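import Literature.Analysis.ODE.LinearPeriodicAveraging
import Mathlib.Analysis.Normed.Algebra.MatrixExponential
import Mathlib.Analysis.CStarAlgebra.Matrix
import HarnessLib

/-!
# Two-sided bounds for the semigroup `exp(-tḠ)` of a coercive / bounded operator and the LOEWNER PINCH
# `e^{-bt}|v|² ≤ vᵀ e^{-tB} v ≤ e^{-at}|v|²` for a symmetric matrix with `a|v|² ≤ vᵀBv ≤ b|v|²`
# (Khalil, *Nonlinear Systems*, Thm 4.10 with `V = ‖x‖²`, both directions; Horn–Johnson, *Matrix
# Analysis*, Thm 4.2.2 (Rayleigh) for the symmetric framing)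

Topic `Literature/Analysis/ODE` (namespace `Literature.Analysis.ODE.PeriodicAveraging`, continuing
`LinearPeriodicAveraging.lean`). Everything here is PROVED (no named fact, no definition, no instance).

* `le_norm_exp_neg_smul_apply` — on a real Hilbert space, `⟪Ḡ v, v⟫ ≤ b‖v‖²` for all `v` gives the
  LOWER bound `e^{-bτ}‖v‖ ≤ ‖exp(-τḠ) v‖` (`τ ≥ 0`); the upper bound `‖exp(-τḠ) v‖ ≤ e^{-aτ}‖v‖` from
  `a‖v‖² ≤ ⟪Ḡ v, v⟫` is `norm_exp_neg_smul_apply_le` of the companion file. (Energy identity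
  `d/dτ ‖z‖² = -2⟪Ḡ z, z⟫` and the comparison lemma — Khalil's proof of Thm 4.10 with `k₁ = k₂ = 1`.)
* `sum_sq_exp_neg_smul_mulVec_le` / `le_sum_sq_exp_neg_smul_mulVec` — the same for a real `m × m`
  matrix `B` and the matrix exponential `NormedSpace.exp (-(τ • B))` acting by `*ᵥ`, with the
  quadratic-form hypotheses `a Σvᵢ² ≤ Σᵢⱼ vᵢ Bᵢⱼ vⱼ` resp. `Σᵢⱼ vᵢ Bᵢⱼ vⱼ ≤ b Σvᵢ²` (no symmetry):
  `Σᵢ ((e^{-τB} v)ᵢ)² ≤ e^{-2aτ} Σ vᵢ²` resp. `≥ e^{-2bτ} Σ vᵢ²`.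
* `dotProduct_exp_neg_smul_mulVec_le` / `le_dotProduct_exp_neg_smul_mulVec` — **the Loewner pinch**
  for a SYMMETRIC `B`: `e^{-bτ} Σvᵢ² ≤ Σᵢ vᵢ (e^{-τB} v)ᵢ ≤ e^{-aτ} Σvᵢ²` (`τ ≥ 0`), via
  `vᵀ e^{-τB} v = |e^{-(τ/2)B} v|²` (`dotProduct_exp_neg_smul_mulVec_eq_sum_sq`: semigroup property and
  symmetry of `e^{-(τ/2)B}`, Mathlib's `Matrix.IsSymm.exp`). This is the scalar functional calculus
  `f(b) ≤ f(B) ≤ f(a)` in the Loewner order for the decreasing function `f(x) = e^{-τx}`, obtained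
  without the spectral theorem; integrating in `τ` against non-negative weights gives the same pinch for
  Laplace-type matrix functions such as the quasi-static slot response `T∫∫ a(s)a(x)e^{-T(s-x)B}` of the
  K1L window plan (`LoewnerWindowSketch` S1/S2).

## Mathlib / tree search

`Matrix.IsSymm.exp`, `Matrix.exp_add_of_commute`, `Matrix.toEuclideanCLM` (+ `toEuclideanCLM_toLp`),
`EuclideanSpace.real_norm_sq_eq`, `dotProduct_mulVec`, `mulVec_transpose`, and from
`LinearPeriodicAveraging.lean`: `norm_exp_neg_smul_apply_le`, `eq_exp_neg_smul_apply`,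
`hasDerivAt_exp_neg_smul_mulVec` (used). No Loewner-order functional calculus for `exp` in Mathlib
(`Matrix.PosSemidef` has `sqrt`/`rpow` via the spectral theorem only).

## References

* H. K. Khalil, *Nonlinear Systems*, 3rd ed., Prentice Hall (2002), §4.5 Theorem 4.10 and its proof
  (comparison lemma for `V̇ ≤ -(k₃/k₂)V`; here also `V̇ ≥ -2b V`). [`Khalil2002`]
* R. A. Horn, C. R. Johnson, *Matrix Analysis*, 2nd ed., CUP (2012), Theorem 4.2.2 (Rayleigh:
  `λ_min ≤ x*Ax ≤ λ_max` on unit vectors; held `book:horn2012-matrix-analysis`, PDF p. 303). [`HornJohnson2012`]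
-/

noncomputable section

open NormedSpace Set Matrix
open scoped InnerProductSpace

namespace Literature.Analysis.ODE.PeriodicAveraging

section Hilbert

variable {E : Type*} [NormedAddCommGroup E] [InnerProductSpace ℝ E] [CompleteSpace E]

/-- Applied derivative of the semigroup (re-proved here; private in the companion file). [folklore] -/
private theorem hasDerivAt_exp_neg_smul_apply' (G : E →L[ℝ] E) (v : E) (σ : ℝ) :
    HasDerivAt (fun u : ℝ => exp (-(u • G)) v) (-(G (exp (-(σ • G)) v))) σ := by
  have h0 : HasDerivAt (fun u : ℝ => exp (-(u • G))) (-(exp (-(σ • G)) * G)) σ := by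
    have h := hasDerivAt_exp_smul_const (-G) σ
    simp only [smul_neg, mul_neg] at h
    exact h
  have hc : Commute (-(σ • G)) G := ((Commute.refl G).smul_left σ).neg_left
  have h := h0.clm_apply (hasDerivAt_const σ v)
  rw [hc.exp_left.eq] at h
  simpa [mul_apply_eq_comp] using h

/-- **Lower semigroup bound**: `⟪Ḡ v, v⟫ ≤ b ‖v‖²` for all `v` gives `e^{-bτ}‖v‖ ≤ ‖exp(-τḠ) v‖` for
`τ ≥ 0`. [cite: Khalil2002, Theorem 4.10 (proof, comparison lemma; reversed inequality)] -/
theorem le_norm_exp_neg_smul_apply (G : E →L[ℝ] E) {b : ℝ}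
    (hup : ∀ v : E, ⟪G v, v⟫_ℝ ≤ b * ‖v‖ ^ 2) (v : E) {τ : ℝ} (hτ : 0 ≤ τ) :
    Real.exp (-(b * τ)) * ‖v‖ ≤ ‖exp (-(τ • G)) v‖ := by
  set z : ℝ → E := fun u => exp (-(u • G)) v with hz
  set φ : ℝ → ℝ := fun u => Real.exp (2 * b * u) * ‖z u‖ ^ 2 with hφ
  have hzd : ∀ u, HasDerivAt z (-(G (z u))) u := fun u => hasDerivAt_exp_neg_smul_apply' G v u
  have hφd : ∀ u, HasDerivAt φ (Real.exp (2 * b * u) * (2 * b) * ‖z u‖ ^ 2 +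
      Real.exp (2 * b * u) * (2 * ⟪z u, -(G (z u))⟫_ℝ)) u := by
    intro u
    have h1 : HasDerivAt (fun u => Real.exp (2 * b * u)) (Real.exp (2 * b * u) * (2 * b)) u := by
      have := ((hasDerivAt_id u).const_mul (2 * b)).exp
      simpa using this
    exact h1.mul (hzd u).norm_sq
  have hφ' : ∀ u, 0 ≤ Real.exp (2 * b * u) * (2 * b) * ‖z u‖ ^ 2 +
      Real.exp (2 * b * u) * (2 * ⟪z u, -(G (z u))⟫_ℝ) := by
    intro u
    rw [inner_neg_right, real_inner_comm]
    have hc := hup (z u)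
    have hpos := Real.exp_pos (2 * b * u)
    nlinarith [hc, hpos]
  have hmono : Monotone φ := monotone_of_hasDerivAt_nonneg hφd hφ'
  have hφτ : φ 0 ≤ φ τ := hmono hτ
  have hφ0 : φ 0 = ‖v‖ ^ 2 := by simp [hφ, hz]
  rw [hφ0] at hφτ
  have hexp : Real.exp (2 * b * τ) * Real.exp (-(b * τ)) ^ 2 = 1 := by
    rw [← Real.exp_nat_mul, ← Real.exp_add]; norm_num; ring_nf
  have hsq : (Real.exp (-(b * τ)) * ‖v‖) ^ 2 ≤ ‖z τ‖ ^ 2 := by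
    have hpos := Real.exp_pos (2 * b * τ)
    have : Real.exp (2 * b * τ) * (Real.exp (-(b * τ)) * ‖v‖) ^ 2 ≤
        Real.exp (2 * b * τ) * ‖z τ‖ ^ 2 := by
      calc Real.exp (2 * b * τ) * (Real.exp (-(b * τ)) * ‖v‖) ^ 2 = ‖v‖ ^ 2 := by
            rw [mul_pow, ← mul_assoc, hexp, one_mul]
        _ ≤ φ τ := hφτ
        _ = Real.exp (2 * b * τ) * ‖z τ‖ ^ 2 := rfl
    exact le_of_mul_le_mul_left this hpos
  have hnn : 0 ≤ Real.exp (-(b * τ)) * ‖v‖ := mul_nonneg (Real.exp_pos _).le (norm_nonneg _)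
  exact (pow_le_pow_iff_left₀ hnn (norm_nonneg _) two_ne_zero).1 hsq

end Hilbert

section MatrixForm

variable {m : ℕ}

/-- Coordinates of the quadratic form of `Matrix.toEuclideanCLM B`. [folklore] -/
private theorem inner_toEuclideanCLM_self (B : Matrix (Fin m) (Fin m) ℝ) (x : EuclideanSpace ℝ (Fin m)) :
    ⟪Matrix.toEuclideanCLM (𝕜 := ℝ) (n := Fin m) B x, x⟫_ℝ = ∑ i, ∑ j, x i * B i j * x j := by
  rw [real_inner_comm, Matrix.inner_toEuclideanCLM]
  simp only [dotProduct, mulVec, Finset.mul_sum]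
  exact Finset.sum_congr rfl fun i _ => Finset.sum_congr rfl fun j _ => by ring

/-- `‖toLp w‖² = Σ wᵢ²`. [folklore] -/
private theorem norm_toLp_sq (w : Fin m → ℝ) : ‖WithLp.toLp 2 w‖ ^ 2 = ∑ i, w i ^ 2 :=
  EuclideanSpace.real_norm_sq_eq _

/-- The bridge: the matrix-exponential orbit is the operator-exponential orbit (by uniqueness of the
linear flow). [folklore] -/
private theorem toLp_exp_neg_smul_mulVec (B : Matrix (Fin m) (Fin m) ℝ) (v : Fin m → ℝ) {σ : ℝ}
    (hσ : 0 ≤ σ) :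
    WithLp.toLp 2 ((NormedSpace.exp (-(σ • B))).mulVec v) =
      NormedSpace.exp (-(σ • Matrix.toEuclideanCLM (𝕜 := ℝ) (n := Fin m) B)) (WithLp.toLp 2 v) := by
  set G := Matrix.toEuclideanCLM (𝕜 := ℝ) (n := Fin m) B with hG
  set z : ℝ → EuclideanSpace ℝ (Fin m) :=
    fun u => WithLp.toLp 2 ((NormedSpace.exp (-(u • B))).mulVec v) with hz
  have hzd : ∀ s ∈ Icc 0 σ, HasDerivAt z (-(G (z s))) s := by
    intro s _
    have h := (PiLp.continuousLinearEquiv 2 ℝ (fun _ : Fin m => ℝ)).symm.toContinuousLinearMap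
      |>.hasFDerivAt.comp_hasDerivAt s (hasDerivAt_exp_neg_smul_mulVec B v s)
    have heq : (PiLp.continuousLinearEquiv 2 ℝ (fun _ : Fin m => ℝ)).symm.toContinuousLinearMap
        (-(B.mulVec ((NormedSpace.exp (-(s • B))).mulVec v))) = -(G (z s)) := by
      rw [hG, hz]
      simp only [Matrix.toEuclideanCLM_toLp]
      rfl
    rw [heq] at h
    exact h
  have h := eq_exp_neg_smul_apply G z hσ hzd
  have hz0 : z 0 = WithLp.toLp 2 v := by simp [hz]
  rw [hz0] at h
  exact h

/-- **Upper bound for the matrix semigroup** (no symmetry): `a Σvᵢ² ≤ Σᵢⱼ vᵢBᵢⱼvⱼ` for all `v` gives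
`Σᵢ ((e^{-τB} v)ᵢ)² ≤ e^{-2aτ} Σᵢ vᵢ²` for `τ ≥ 0`.
[cite: Khalil2002, Theorem 4.10 (linear case, `V = ‖x‖²`)] -/
theorem sum_sq_exp_neg_smul_mulVec_le (B : Matrix (Fin m) (Fin m) ℝ) {a : ℝ}
    (ha : ∀ v : Fin m → ℝ, a * ∑ i, v i ^ 2 ≤ ∑ i, ∑ j, v i * B i j * v j) (v : Fin m → ℝ) {τ : ℝ}
    (hτ : 0 ≤ τ) :
    ∑ i, ((NormedSpace.exp (-(τ • B))).mulVec v i) ^ 2 ≤ Real.exp (-(2 * a * τ)) * ∑ i, v i ^ 2 := by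
  set G := Matrix.toEuclideanCLM (𝕜 := ℝ) (n := Fin m) B with hG
  have hcoer : ∀ x : EuclideanSpace ℝ (Fin m), a * ‖x‖ ^ 2 ≤ ⟪G x, x⟫_ℝ := fun x => by
    rw [hG, inner_toEuclideanCLM_self, EuclideanSpace.real_norm_sq_eq]; exact ha _
  have h := norm_exp_neg_smul_apply_le G hcoer (WithLp.toLp 2 v) hτ
  rw [← toLp_exp_neg_smul_mulVec B v hτ] at h
  have hnn : 0 ≤ Real.exp (-(a * τ)) * ‖WithLp.toLp 2 v‖ :=
    mul_nonneg (Real.exp_pos _).le (norm_nonneg _)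
  have h2 := pow_le_pow_left₀ (norm_nonneg _) h 2
  rw [norm_toLp_sq, mul_pow, norm_toLp_sq, ← Real.exp_nat_mul] at h2
  have he : Real.exp (↑(2:ℕ) * -(a * τ)) = Real.exp (-(2 * a * τ)) := by congr 1; push_cast; ring
  rw [he] at h2
  exact h2

/-- **Lower bound for the matrix semigroup** (no symmetry): `Σᵢⱼ vᵢBᵢⱼvⱼ ≤ b Σvᵢ²` for all `v` gives
`e^{-2bτ} Σᵢ vᵢ² ≤ Σᵢ ((e^{-τB} v)ᵢ)²` for `τ ≥ 0`.
[cite: Khalil2002, Theorem 4.10 (linear case, reversed comparison)] -/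
theorem le_sum_sq_exp_neg_smul_mulVec (B : Matrix (Fin m) (Fin m) ℝ) {b : ℝ}
    (hb : ∀ v : Fin m → ℝ, ∑ i, ∑ j, v i * B i j * v j ≤ b * ∑ i, v i ^ 2) (v : Fin m → ℝ) {τ : ℝ}
    (hτ : 0 ≤ τ) :
    Real.exp (-(2 * b * τ)) * ∑ i, v i ^ 2 ≤ ∑ i, ((NormedSpace.exp (-(τ • B))).mulVec v i) ^ 2 := by
  set G := Matrix.toEuclideanCLM (𝕜 := ℝ) (n := Fin m) B with hG
  have hup : ∀ x : EuclideanSpace ℝ (Fin m), ⟪G x, x⟫_ℝ ≤ b * ‖x‖ ^ 2 := fun x => by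
    rw [hG, inner_toEuclideanCLM_self, EuclideanSpace.real_norm_sq_eq]; exact hb _
  have h := le_norm_exp_neg_smul_apply G hup (WithLp.toLp 2 v) hτ
  rw [← toLp_exp_neg_smul_mulVec B v hτ] at h
  have hnn : 0 ≤ Real.exp (-(b * τ)) * ‖WithLp.toLp 2 v‖ :=
    mul_nonneg (Real.exp_pos _).le (norm_nonneg _)
  have h2 := pow_le_pow_left₀ hnn h 2
  rw [norm_toLp_sq, mul_pow, norm_toLp_sq, ← Real.exp_nat_mul] at h2
  have he : Real.exp (↑(2:ℕ) * -(b * τ)) = Real.exp (-(2 * b * τ)) := by congr 1; push_cast; ring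
  rw [he] at h2
  exact h2

/-- **Symmetric case: the quadratic form of `e^{-τB}` is a square**, `vᵀ e^{-τB} v = |e^{-(τ/2)B} v|²`
(semigroup property and symmetry of `e^{-(τ/2)B}`). [cite: HornJohnson2012, Theorem 4.2.2 (Rayleigh),
applied to the symmetric matrix `e^{-(τ/2)B}`; Mathlib `Matrix.IsSymm.exp`] -/
theorem dotProduct_exp_neg_smul_mulVec_eq_sum_sq {B : Matrix (Fin m) (Fin m) ℝ} (hB : B.IsSymm)
    (v : Fin m → ℝ) (τ : ℝ) :
    ∑ i, v i * (NormedSpace.exp (-(τ • B))).mulVec v i =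
      ∑ i, ((NormedSpace.exp (-((τ / 2) • B))).mulVec v i) ^ 2 := by
  set Eh : Matrix (Fin m) (Fin m) ℝ := NormedSpace.exp (-((τ / 2) • B)) with hEh
  have hsymm : Eh.IsSymm := by
    rw [hEh]
    exact (hB.smul (τ / 2)).neg.exp
  have hsplit : NormedSpace.exp (-(τ • B)) = Eh * Eh := by
    rw [hEh, ← Matrix.exp_add_of_commute _ _ (Commute.refl _), ← neg_add, ← add_smul, add_halves]
  rw [hsplit, ← Matrix.mulVec_mulVec]
  have h1 : ∑ i, v i * (Eh.mulVec (Eh.mulVec v)) i = v ⬝ᵥ (Eh.mulVec (Eh.mulVec v)) := rfl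
  rw [h1, Matrix.dotProduct_mulVec, ← Matrix.mulVec_transpose, hsymm.eq]
  simp only [dotProduct, sq]

/-- **THE LOEWNER PINCH, upper half**: for a SYMMETRIC `B` with `a Σvᵢ² ≤ Σᵢⱼ vᵢBᵢⱼvⱼ` (all `v`),
`Σᵢ vᵢ (e^{-τB} v)ᵢ ≤ e^{-aτ} Σᵢ vᵢ²` for `τ ≥ 0` — `e^{-τB} ≤ e^{-aτ}·1` in the Loewner order.
[cite: HornJohnson2012, Theorem 4.2.2 (Rayleigh); Khalil2002, Theorem 4.10] -/
theorem dotProduct_exp_neg_smul_mulVec_le {B : Matrix (Fin m) (Fin m) ℝ} (hB : B.IsSymm) {a : ℝ}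
    (ha : ∀ v : Fin m → ℝ, a * ∑ i, v i ^ 2 ≤ ∑ i, ∑ j, v i * B i j * v j) (v : Fin m → ℝ) {τ : ℝ}
    (hτ : 0 ≤ τ) :
    ∑ i, v i * (NormedSpace.exp (-(τ • B))).mulVec v i ≤ Real.exp (-(a * τ)) * ∑ i, v i ^ 2 := by
  rw [dotProduct_exp_neg_smul_mulVec_eq_sum_sq hB]
  have h := sum_sq_exp_neg_smul_mulVec_le B ha v (by linarith : 0 ≤ τ / 2)
  convert h using 2; ring_nf

/-- **THE LOEWNER PINCH, lower half**: for a SYMMETRIC `B` with `Σᵢⱼ vᵢBᵢⱼvⱼ ≤ b Σvᵢ²` (all `v`),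
`e^{-bτ} Σᵢ vᵢ² ≤ Σᵢ vᵢ (e^{-τB} v)ᵢ` for `τ ≥ 0` — `e^{-bτ}·1 ≤ e^{-τB}` in the Loewner order.
[cite: HornJohnson2012, Theorem 4.2.2 (Rayleigh); Khalil2002, Theorem 4.10] -/
theorem le_dotProduct_exp_neg_smul_mulVec {B : Matrix (Fin m) (Fin m) ℝ} (hB : B.IsSymm) {b : ℝ}
    (hb : ∀ v : Fin m → ℝ, ∑ i, ∑ j, v i * B i j * v j ≤ b * ∑ i, v i ^ 2) (v : Fin m → ℝ) {τ : ℝ}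
    (hτ : 0 ≤ τ) :
    Real.exp (-(b * τ)) * ∑ i, v i ^ 2 ≤ ∑ i, v i * (NormedSpace.exp (-(τ • B))).mulVec v i := by
  rw [dotProduct_exp_neg_smul_mulVec_eq_sum_sq hB]
  have h := le_sum_sq_exp_neg_smul_mulVec B hb v (by linarith : 0 ≤ τ / 2)
  convert h using 2; ring_nf

/-- Symmetry of the matrix exponential's bilinear form: `u ⬝ e^{-τB} v = v ⬝ e^{-τB} u` for symmetric
`B`. [cite: HornJohnson2012, Theorem 4.2.2 (Rayleigh) — symmetric framing; Mathlib `Matrix.IsSymm.exp`] -/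
theorem dotProduct_exp_neg_smul_mulVec_comm {B : Matrix (Fin m) (Fin m) ℝ} (hB : B.IsSymm)
    (u v : Fin m → ℝ) (τ : ℝ) :
    ∑ i, u i * (NormedSpace.exp (-(τ • B))).mulVec v i =
      ∑ i, v i * (NormedSpace.exp (-(τ • B))).mulVec u i := by
  have hsymm : (NormedSpace.exp (-(τ • B))).IsSymm := (hB.smul τ).neg.exp
  have h1 : ∑ i, u i * (NormedSpace.exp (-(τ • B))).mulVec v i =
      u ⬝ᵥ (NormedSpace.exp (-(τ • B))).mulVec v := rfl
  have h2 : ∑ i, v i * (NormedSpace.exp (-(τ • B))).mulVec u i =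
      v ⬝ᵥ (NormedSpace.exp (-(τ • B))).mulVec u := rfl
  rw [h1, h2, Matrix.dotProduct_mulVec, ← Matrix.mulVec_transpose, hsymm.eq, dotProduct_comm]

end MatrixForm

end Literature.Analysis.ODE.PeriodicAveraging

end
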